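import Literature.MathematicalPhysics.QuantumFieldTheory.Balaban1983to89.B9Eq353FormDefectTowerPiTwoBackgrounds
import Literature.MathematicalPhysics.QuantumFieldTheory.Balaban1983to89.B9Thm311LaplaceAkPiPositiveDiagonal
import Literature.MathematicalPhysics.QuantumFieldTheory.Balaban1983to89.B9Eq386GreenAnalyticPencilEnergy

/-!
# `Balaban1983to89.B9Eq386GreenkAnalyticPencilEnergyPiTwoBackgrounds` — T. Bałaban, *Propagators for lattice gauge theories in a background field*, Commun.
# Math. Phys. **99** (1985) 389–434 [Balaban1985BackgroundPropagators] (3.122) p. 420, Thm 3.4 p. 400, (3.52)–(3.53) p. 400, (3.84)–(3.86) p. 407, Thm 3.11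
# p. 416, with T. Kato, *Perturbation theory for linear operators* (1966) [Kato1966] Ch. VII §4: **PRINT's `k`-TH-STEP OPERATOR `Δ̃_{a,k}` ((3.122)) AT TWO
# SMALL BACKGROUNDS AS A LINEAR PENCIL IN THE FLAT ENERGY WEIGHT — for `S(z) = Δ̃_{a,k}(U) + z(Δ̃_{a,k}(V) − Δ̃_{a,k}(U))`: `z ↦ S(z)⁻¹` is ANALYTIC on
# `‖z‖ ≤ R₁` whenever `R₁Θδ < γ`, `‖S(z)⁻¹‖ ≤ (γ − R₁Θδ)⁻¹`, `‖∂_zⁿS(z)⁻¹|₀‖ ≤ n!(γ − R₁Θδ)⁻¹R₁⁻ⁿ`, `N₁(S(z)⁻¹y) ≤ (γ − R₁Θδ)⁻¹‖y‖`, and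
# `‖Δ̃_{a,k}(V)⁻¹ − Δ̃_{a,k}(U)⁻¹‖ ≤ (γ − R₁Θδ)⁻¹∕(R₁ − 1)`, with ONE `∃ α₀ δ₀ γ Θ` BEFORE EVERY BINDER; the algebra inverse IS the tree's `G̃_k`** — the
# (3.122) π-slot junction ((T4)) of ne9-leaf-01's abstract pencil `B9Eq386GreenAnalyticPencilEnergy` (t4-ne9-idea-1's N53) with this lineage's π letters
# `B9Thm311LaplaceAkPiPositiveDiagonal` (coercivity `γ` of `Δ̃_{a,k}(U)` in the flat weight) and `B9Eq353FormDefectTowerPiTwoBackgrounds` (form defect `Θδ`)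

statement-level skeleton of published theorems with citation tags; proofs where landed; nothing here is a claim about the Yang–Mills mass gap

PDF held: `paper:balaban1985-cmp99-background-propagators` (journal page = PDF page + 388), pp. 400, 407, 416, 420 — read by this lineage first-hand (gens 73–79)
and through the suppliers' verbatim quotations.

CITATION HEADER (lean-in-tree rule 2026-08-18).  Audit cell `pub-balaban`, sub-cell `t4`, NE9 crux team (2): LEAF PROVER 04 (`b2b-balaban-t4-ne9-formalise-leaf-04`
gen 82).  The junction was located by lane in the cell journal (ne9-leaf-01 g88 W-2 2026-08-25 l.63785 and LANDED-7 l.64448 «the (T4)-slot reading after I-7 ✓ is yours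
by lane — `norm_inverse_add_sub_inverse_le` ∕ `norm_iteratedDeriv_inverse_pencil_le` are the by-name sockets»; t4-ne9-idea-1 g152 W-6 l.63885 «AGREED AS WORDED …
the flat energy norm of the (3.122) ball carries the `‖f‖²` term, so N53 §2's `N ≥ ‖·‖` is met»).  CREDIT: the pencil mechanism is t4-ne9-idea-1 g152's N53
(«Kato type-(B) in the covariant energy weight»), typed by ne9-leaf-01 g88 as `B9Eq386GreenAnalyticPencilEnergy` (p396390); its `Δ_a`-slot lattice junction is
ne9-leaf-01 g88's `B9Eq326ConjugatedDeltaATwoBackgroundsPencil` (p396465) — THIS file is the same junction at print's operator (3.122), over this lineage's gen-79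
π letters.  Imports `B9Eq353FormDefectTowerPiTwoBackgrounds` ((T4)-1, `exists_form_defect_pi_two_backgrounds_letterfree`), the row OWNER t4-ne9-p1's
`B9Thm311LaplaceAkPiPositiveDiagonal` (`exists_laplaceAkPi_coercive_diagonal_closed`) and `B9Eq386GreenAnalyticPencilEnergy` (`norm_iteratedDeriv_inverse_pencil_le`,
`analyticAt_inverse_pencil`, `norm_inverse_pencil_le`, `weight_inverse_pencil_apply_le`, `norm_inverse_add_sub_inverse_le`, `inverse_apply_eq_greenK`).  Sources
READ first-hand in the held text layer (PDF pp. 12, 19, 32): p. 400 *«Theorem 3.4. There exists a positive constant a₁ such that the operators G′(U),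
(Q′(U)G′²(U)Q′*(U))⁻¹, R(U), G(U) extend to configurations U′U for α₁ ≤ a₁ as analytic functions of A. The extended operators satisfy all the inequalities of
Theorems 3.1–3.3 correspondingly. In fact we prove quantitative statements which are more precise, describing these analytic extensions as small perturbations
of the operators depending on U only»*; p. 407 (3.86) *«G(U′U) = G(U)(I − V(A)G(U))⁻¹ = Σ_{n ≥ 0} G(U)(V(A)G(U))ⁿ … and convergence is in the operator norm for
α₁ sufficiently small. Each term in the series is an analytic function of A in the domain (3.37)»*; p. 420 *«It differs from the operator investigated in
previous sections by the additional term Δ′_π, but we will prove that this term is a small perturbation of Δ_a, and that the operator G used in the above formula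
has all the properties formulated in Theorems 3.3, 3.10, 3.11»*.  Print's analyticity is the operator-norm Neumann series (3.86); the
form-currency LINEAR pencil between two points of the small-field ball is the ROUTE's substitute (`t4/ROUTES-NE9.md` §L1.4, N52 road (α) ∕ N53); nothing of
print's radius is asserted.

WHY THIS FILE (cell context).  NE9 compares the `k`-th-step letters of two coupling histories, i.e. at two small backgrounds `U`, `V`; at print's operator (3.122)
this lineage's gen-79 rows (`B9Eq386GreenkLipschitzEnergyPiTwoBackgrounds` → `…H1k∕FrakGk…PiTwoBackgrounds` → `B9Eq3126EnergyBallTowerPiTwoBackgrounds` →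
`B11Eq117∕174…TowerPiTwoBackgrounds`) are the FIRST order in the closeness `δ`.  The same two letters they start from — the coercivity `γ` of `Δ̃_{a,k}(U)` in the
flat energy weight `N₁(w) = √(‖curl₁w‖² + ‖div₁w‖² + ‖w‖²)` and the two-background form defect `‖⟨u, Δ̃_{a,k}(U)v⟩ − ⟨u, Δ̃_{a,k}(V)v⟩‖ ≤ Θδ·N₁(u)N₁(v)` — are
EXACTLY the `hco` ∕ `hD` letters of the abstract pencil with `S₀ := Δ̃_{a,k}(U)`, `D := Δ̃_{a,k}(V) − Δ̃_{a,k}(U)` (`N₁ ≥ ‖·‖` because the (3.122) ball carries the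
`‖w‖²` term), so ALL ORDERS in the direction `Δ̃_{a,k}(V) − Δ̃_{a,k}(U)` follow BY NAME, with every constant a function of `(γ, Θδ, R₁)` only.

WHAT IS PROVED (sorry-free; proof lane — no `def`, no `Prop` placeholder; [folklore] composition BY NAME; `𝕜 = ℂ`).
* §1 **`inverse_toContinuousLinearMap_apply_eq_greenK`** — for ANY positive `H : E →ₗ[ℂ] E` on a finite-dimensional Hilbert space and any witness `hpos`:
  `Ring.inverse (toContinuousLinearMap H) y = greenK H hpos y` (I-7's `inverse_apply_eq_greenK` through the coercion) — so the pencil's `z = 0, 1` members below ARE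
  the tree's `G̃_k(U) = greenK (laplaceAkPi … U …) hposU`, `G̃_k(V)`, for ANY positivity witnesses.
* §2 **`exists_inverse_laplaceAkPi_pencil_two_backgrounds_letterfree`** — `∃ α₀ δ₀ γ Θ > 0` (closed in `(d, a, a′, L, M_φ, M_φ′, r, C_τ, ρ_w)`) such that under
  the binder list of `B9Eq386GreenkLipschitzEnergyPiTwoBackgrounds` (E162's per-level data at `U` and `V`, the base at `V` `≤ 1∕128`; level smallness `ε_j ≤ αr^j`
  (`j < n+1`) and closeness `δ_j ≤ δr^j`; `hRS` ×2, `U1` ×2, bond ∕ plaquette windows ×2, closeness `δη` ∕ `δη²`; `0 ≤ α ≤ α₀`, `0 ≤ δ ≤ δ₀`; ANY `hpos′_U`,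
  `hpos′_V` defining `G′_k`) — NO positivity witness of `Δ̃_{a,k}` needed — with `S₀ := toContinuousLinearMap (laplaceAkPi … U …)`, `S₁ := … V …`, `D := S₁ − S₀`,
  for every radius `0 < R₁` with `R₁(Θδ) < γ`:
  [C] `‖iteratedDeriv ν (z ↦ (S₀ + z•D)⁻¹) 0‖ ≤ ν!·(γ − R₁Θδ)⁻¹∕R₁^ν` (every `ν`);  [A] `z ↦ (S₀ + z•D)⁻¹` analytic at every `‖z‖ ≤ R₁`;
  [B] `‖(S₀ + z•D)⁻¹‖ ≤ (γ − R₁Θδ)⁻¹` on the disc;  [R] `N₁((S₀ + z•D)⁻¹y) ≤ (γ − R₁Θδ)⁻¹‖y‖` on the disc (the energy rows ride along);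
  [L] `1 < R₁ ⟹ ‖S₁⁻¹ − S₀⁻¹‖ ≤ (γ − R₁Θδ)⁻¹∕(R₁ − 1)` (the two-background difference of the algebra inverses by the mean value theorem on the pencil).
  MECHANISM: `exists_laplaceAkPi_coercive_diagonal_closed` at `U` (its averaged `U1` letters from E162's data by `hLb_of_hU1`) = `hco`;
  `exists_form_defect_pi_two_backgrounds_letterfree` = `hD` with `Θ ↦ Θδ`; then `B9Eq386GreenAnalyticPencilEnergy` §4 BY NAME; `α₀` the minimum.
* §3 **`exists_inverse_laplaceAkPi_sub_inverse_le_two_backgrounds_letterfree`** — the SMALL first order read off [L]: under the same binders with `0 < δ` and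
  the window `Θδ < γ`, the midpoint radius `R₁⋆ := (γ + Θδ)∕(2Θδ) ∈ (1, γ∕(Θδ))` gives `‖S₁⁻¹ − S₀⁻¹‖ ≤ 4Θδ∕(γ − Θδ)²` — order `Θδ∕γ²`, the order of (T4)-2's
  `(Θ∕γ)γ⁻¹δ` (`B9Eq386GreenkLipschitzEnergyPiTwoBackgrounds`) with a WORSE constant: this file is the all-orders statement, not a better first order (radius
  choice: t4-ne9-idea-1 g153, L-g153-3).
MODEL ∕ DECLARED READINGS.  Those of (T4)-1 ∕ (T4)-2: every window ∕ profile ∕ closeness letter, E162's data, `hRS`, `ρ_w` and the witnesses `hpos′` are HYPOTHESES;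
the Lipschitz continuity `U ↦ Ū` of the level averages (`δ_j`) is NOT proved; `R₁` free.
HONEST SCOPE.  [folklore] composition BY NAME, 0 new estimate; the LINEAR operator pencil between two points of the small-field ball — NOT the GROUP pencil
`z ↦ Δ̃_{a,k}(U·e^{zηA})` of print's Thm 3.4 (t4-ne9-idea-1 g153's N54, not typed here), NOT print's (3.86) in operator currency, no kernel bound (3.42)–(3.47), no decay
(Thm 3.10), no Hölder norms; the first order [L]∕§3 is WORSE than (T4)-2's by a constant — this file is the all-orders statement, not a better first order; crude
constants.  NOT summit progress (cell pub-balaban: NE9 NOT PRINTED ∕ NOT PROVED; «NE9 ⇐ the named binders»; row WALLED ON A MODEL (O-NE9-1; NEEDS-COORDINATOR #5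
UNRULED); spine PROVED 0∕9; rung (B)+1 finite T⁴ — NOT infinite volume, NOT mass gap, NOT BetaPertH, NOT Clay).  HONEST DEPENDENCY (cell line): continuum YM on T⁴ ⇐
BetaPertH ∧ nine spine estimates (0/9 proved); BetaPertH ⇐ (D1) ∧ (D4) ∧ CAP+tail; G-an2-4 gates asym, D1 and NE2/3/4.  NEW file; nothing modified.  Net new unproved
facts: 0.
-/

noncomputable section

open scoped InnerProductSpace ComplexConjugate BigOperators

namespace Literature.MathematicalPhysics.QuantumFieldTheory.Balaban1983to89.B9Eq386GreenkAnalyticPencilEnergyPiTwoBackgrounds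

open B4Sect5Torus (TSite)
open B9SectCLatticeCarrier (Bond)
open B11Eq103H1Complex (SiteL2K BondL2K covDivL2K greenK)
open B9Eq310HessianOperator (adTransportW covCurlL2K)
open B9Eq310DeltaPrime (plaqHolU)
open B9Eq315QTorus (perCfg cornerSite)
open B9Eq315QTower (towerP UlevOf)
open B9Eq324DeltaPrimeATower (laplacePrimeAk)
open B9Eq3119DeltaPiTower (laplaceAkPi)
open B7Prop1Explicit (U1 Wcx boxVec)
open B9Thm311SmallFieldCoercivityTowerClosed (hLb_of_hU1)
open B9Thm311LaplaceAkPiPositiveDiagonal (exists_laplaceAkPi_coercive_diagonal_closed)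
open B9Eq353FormDefectTowerPiTwoBackgrounds (exists_form_defect_pi_two_backgrounds_letterfree)
open B9Eq386GreenAnalyticPencilEnergy (inverse_apply_eq_greenK norm_inverse_pencil_le analyticAt_inverse_pencil norm_iteratedDeriv_inverse_pencil_le
  norm_inverse_add_sub_inverse_le weight_inverse_pencil_apply_le)

/-! ## §1 The algebra inverse of a positive operator read as a continuous linear map IS the tree's `greenK` -/

section Identification

variable {E : Type*} [NormedAddCommGroup E] [InnerProductSpace ℂ E] [FiniteDimensional ℂ E]

/-- **`(toContinuousLinearMap H)⁻¹ y = greenK H hpos y`** for ANY positive `H` and ANY witness `hpos` — the pencil's members at `z = 0, 1` are the tree's Green's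
functions (`B9Eq386GreenAnalyticPencilEnergy.inverse_apply_eq_greenK` through the coercion `↑(toContinuousLinearMap H) = H`). [folklore]
[cite: Balaban1985Variational, (110) p.294; Balaban1985BackgroundPropagators, Thm 3.11 p.416, (3.122) p.420] -/
theorem inverse_toContinuousLinearMap_apply_eq_greenK (H : E →ₗ[ℂ] E) (hpos : ∀ x : E, x ≠ 0 → 0 < RCLike.re ⟪x, H x⟫_ℂ) (y : E) :
    Ring.inverse (LinearMap.toContinuousLinearMap H : E →L[ℂ] E) y = greenK H hpos y := by
  have hpos' : ∀ x : E, x ≠ 0 → 0 < RCLike.re ⟪x, ((LinearMap.toContinuousLinearMap H : E →L[ℂ] E) : E →ₗ[ℂ] E) x⟫_ℂ := fun x hx => by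
    rw [ContinuousLinearMap.coe_coe, LinearMap.coe_toContinuousLinearMap']
    exact hpos x hx
  rw [inverse_apply_eq_greenK _ hpos']
  congr 1

end Identification

/-! ## §2 The (3.122) π-slot pencil between two small backgrounds, letter-free -/

/-- `x ≤ √S` from `0 ≤ x` and `x² ≤ S`. [folklore] -/
private theorem le_sqrt_of_sq_le {x S : ℝ} (hx : 0 ≤ x) (h : x ^ 2 ≤ S) : x ≤ Real.sqrt S := by
  rw [← Real.sqrt_sq hx]; exact Real.sqrt_le_sqrt h

variable {d : ℕ} (L : ℕ) [NeZero L] (hL : 1 ≤ L)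
  {𝔸 : Type*} [NormedRing 𝔸] [NormedAlgebra ℂ 𝔸] [CompleteSpace 𝔸] [NormOneClass 𝔸] [StarRing 𝔸] [NormedStarGroup 𝔸] [StarModule ℂ 𝔸]
  {W : Type*} [NormedAddCommGroup W] [InnerProductSpace ℂ W] [FiniteDimensional ℂ W] (φ : W ≃ₗ[ℂ] 𝔸)
  {Mφ Mφ' : ℝ} (hMφ : 0 ≤ Mφ) (hMφ' : 0 ≤ Mφ') (hφ : ∀ w, ‖φ w‖ ≤ Mφ * ‖w‖) (hφ' : ∀ X, ‖φ.symm X‖ ≤ Mφ' * ‖X‖)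
  {a : ℝ} (ha : 0 < a) {a' : ℝ} (ha' : 0 < a') {r : ℝ} (hr0 : 0 ≤ r) (hr1 : r < 1)
  (τ : 𝔸 →ₗ[ℂ] ℂ) {Cτ : ℝ} (hτ : ∀ X, ‖τ X‖ ≤ Cτ * ‖X‖) (hCτ : 0 ≤ Cτ) {ρw : ℝ} (hρw : 0 ≤ ρw)

include hMφ hMφ' hφ hφ' ha ha' hr0 hr1 hτ hCτ hρw

/-- **PRINT's `Δ̃_{a,k}` AT TWO SMALL BACKGROUNDS AS A LINEAR PENCIL IN THE FLAT ENERGY WEIGHT, LETTER-FREE** — see the module header: `∃ α₀ δ₀ γ Θ > 0` before every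
binder; then, with `S₀ := toContinuousLinearMap (Δ̃_{a,k}(U))`, `S₁ := toContinuousLinearMap (Δ̃_{a,k}(V))`, `D := S₁ − S₀`, for every `0 < R₁` with `R₁(Θδ) < γ`:
[C] `‖iteratedDeriv ν (z ↦ (S₀ + z•D)⁻¹) 0‖ ≤ ν!·(γ − R₁Θδ)⁻¹∕R₁^ν`;  [A] analyticity of `z ↦ (S₀ + z•D)⁻¹` on `‖z‖ ≤ R₁`;  [B] `‖(S₀ + z•D)⁻¹‖ ≤ (γ − R₁Θδ)⁻¹` there;
[R] `N₁((S₀ + z•D)⁻¹y) ≤ (γ − R₁Θδ)⁻¹‖y‖` there;  [L] `1 < R₁ ⟹ ‖S₁⁻¹ − S₀⁻¹‖ ≤ (γ − R₁Θδ)⁻¹∕(R₁ − 1)` — `B9Eq386GreenAnalyticPencilEnergy` §4 BY NAME on the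
coercivity of `Δ̃_{a,k}(U)` (`exists_laplaceAkPi_coercive_diagonal_closed`) and the two-background form defect (`exists_form_defect_pi_two_backgrounds_letterfree`).
[folklore] [cite: Balaban1985BackgroundPropagators, (3.122) p.420, Thm 3.4 p.400, (3.52)–(3.53) p.400, (3.84)–(3.86) p.407, Thm 3.11 p.416, (3.35) p.396; Kato1966, Ch. VII §4] -/
theorem exists_inverse_laplaceAkPi_pencil_two_backgrounds_letterfree :
    ∃ α₀ δ₀ γ Θ : ℝ, 0 < α₀ ∧ 0 < δ₀ ∧ 0 < γ ∧ 0 < Θ ∧ ∀ (n : ℕ) (η : ℝ), η * (L : ℝ) ^ (n + 1) = 1 →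
      ∀ (c₀ c₁ : ℝ) [Fact (0 < c₀)] [Fact (0 < c₁)], c₀ * ((L : ℝ) ^ (n + 1)) ^ d = c₁ → |η| ^ d / c₀ ≤ ρw →
      ∀ (m : Fin d → ℕ) [∀ i, NeZero (m i)] (U V : Bond d (towerP L m (n + 1)) → 𝔸ˣ) (αU : ℕ → ℝ) (hα1 : ∀ j, αU j ≤ 1 / 64)
        (hU1 : ∀ (j : ℕ) (x : B7Prop1Explicit.Site d) (κ : Fin d), perCfg (towerP L m (j + 1)) (UlevOf L m (n + 1) U j) x κ ∈ U1 𝔸)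
        (hreg : ∀ (j : ℕ) (y : TSite d (towerP L m j)) (κ : Fin d) (r : Fin d → Fin L),
          ‖((Wcx L (perCfg (towerP L m (j + 1)) (UlevOf L m (n + 1) U j)) (cornerSite L y) κ (boxVec L r) : 𝔸ˣ) : 𝔸) - 1‖ ≤ αU j)
        (αV : ℕ → ℝ) (hα1' : ∀ j, αV j ≤ 1 / 64)
        (hV1 : ∀ (j : ℕ) (x : B7Prop1Explicit.Site d) (κ : Fin d), perCfg (towerP L m (j + 1)) (UlevOf L m (n + 1) V j) x κ ∈ U1 𝔸)
        (hregV : ∀ (j : ℕ) (y : TSite d (towerP L m j)) (κ : Fin d) (r : Fin d → Fin L),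
          ‖((Wcx L (perCfg (towerP L m (j + 1)) (UlevOf L m (n + 1) V j)) (cornerSite L y) κ (boxVec L r) : 𝔸ˣ) : 𝔸) - 1‖ ≤ αV j),
        (∀ j, αV j ≤ 1 / 128) →
      ∀ (εU : ℕ → ℝ), (∀ j, 0 ≤ εU j) → (∀ (j : ℕ) (b : Bond d (towerP L m (j + 1))), ‖(UlevOf L m (n + 1) U j b : 𝔸) - 1‖ ≤ εU j) →
        (∀ (j : ℕ) (b : Bond d (towerP L m (j + 1))), ‖(UlevOf L m (n + 1) V j b : 𝔸) - 1‖ ≤ εU j) →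
      ∀ (δUV : ℕ → ℝ), (∀ j, 0 ≤ δUV j) →
        (∀ (j : ℕ) (b : Bond d (towerP L m (j + 1))), ‖(UlevOf L m (n + 1) U j b : 𝔸) - (UlevOf L m (n + 1) V j b : 𝔸)‖ ≤ δUV j) →
      ∀ {α δ : ℝ}, 0 ≤ α → α ≤ α₀ → 0 ≤ δ → δ ≤ δ₀ →
        (∀ (b : Bond d (towerP L m (n + 1))) (v u : W), ⟪adTransportW φ U b v, u⟫_ℂ = ⟪v, adTransportW φ (fun b => (U b)⁻¹) b u⟫_ℂ) →
        (∀ (b : Bond d (towerP L m (n + 1))) (v u : W), ⟪adTransportW φ V b v, u⟫_ℂ = ⟪v, adTransportW φ (fun b => (V b)⁻¹) b u⟫_ℂ) →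
        (∀ b, U b ∈ U1 𝔸) → (∀ b, V b ∈ U1 𝔸) → (∀ b, ‖(U b : 𝔸) - 1‖ ≤ α * η) → (∀ b, ‖(V b : 𝔸) - 1‖ ≤ α * η) →
        (∀ p : B9SectCLatticeCarrier.Plaq d (towerP L m (n + 1)), ‖(plaqHolU U p : 𝔸) - 1‖ ≤ α * η ^ 2) →
        (∀ p : B9SectCLatticeCarrier.Plaq d (towerP L m (n + 1)), ‖(plaqHolU V p : 𝔸) - 1‖ ≤ α * η ^ 2) →
        (∀ b, ‖(U b : 𝔸) - (V b : 𝔸)‖ ≤ δ * η) →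
        (∀ p : B9SectCLatticeCarrier.Plaq d (towerP L m (n + 1)), ‖(plaqHolU U p : 𝔸) - (plaqHolU V p : 𝔸)‖ ≤ δ * η ^ 2) →
        (∀ j < n + 1, εU j ≤ α * r ^ j) → (∀ j, δUV j ≤ δ * r ^ j) →
        ∀ (hposU' : ∀ x : SiteL2K ℂ d (towerP L m (n + 1)) c₀ W, x ≠ 0 → 0 < RCLike.re ⟪x, laplacePrimeAk L m n φ η U a' (c₁ := c₁) x⟫_ℂ)
          (hposV' : ∀ x : SiteL2K ℂ d (towerP L m (n + 1)) c₀ W, x ≠ 0 → 0 < RCLike.re ⟪x, laplacePrimeAk L m n φ η V a' (c₁ := c₁) x⟫_ℂ)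
          {R₁ : ℝ}, 0 < R₁ → R₁ * (Θ * δ) < γ →
          (∀ ν : ℕ, ‖iteratedDeriv ν (fun w : ℂ =>
              Ring.inverse ((LinearMap.toContinuousLinearMap (laplaceAkPi L m n φ τ η U a' hposU' hL αU hα1 hU1 hreg (c₁ := c₁) a) :
                  BondL2K ℂ d (towerP L m (n + 1)) c₀ W →L[ℂ] BondL2K ℂ d (towerP L m (n + 1)) c₀ W) +
                w • ((LinearMap.toContinuousLinearMap (laplaceAkPi L m n φ τ η V a' hposV' hL αV hα1' hV1 hregV (c₁ := c₁) a) :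
                      BondL2K ℂ d (towerP L m (n + 1)) c₀ W →L[ℂ] BondL2K ℂ d (towerP L m (n + 1)) c₀ W) -
                  (LinearMap.toContinuousLinearMap (laplaceAkPi L m n φ τ η U a' hposU' hL αU hα1 hU1 hreg (c₁ := c₁) a) :
                      BondL2K ℂ d (towerP L m (n + 1)) c₀ W →L[ℂ] BondL2K ℂ d (towerP L m (n + 1)) c₀ W)))) 0‖ ≤
              ν.factorial * (γ - R₁ * (Θ * δ))⁻¹ / R₁ ^ ν) ∧
          (∀ z : ℂ, ‖z‖ ≤ R₁ → AnalyticAt ℂ (fun w : ℂ =>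
              Ring.inverse ((LinearMap.toContinuousLinearMap (laplaceAkPi L m n φ τ η U a' hposU' hL αU hα1 hU1 hreg (c₁ := c₁) a) :
                  BondL2K ℂ d (towerP L m (n + 1)) c₀ W →L[ℂ] BondL2K ℂ d (towerP L m (n + 1)) c₀ W) +
                w • ((LinearMap.toContinuousLinearMap (laplaceAkPi L m n φ τ η V a' hposV' hL αV hα1' hV1 hregV (c₁ := c₁) a) :
                      BondL2K ℂ d (towerP L m (n + 1)) c₀ W →L[ℂ] BondL2K ℂ d (towerP L m (n + 1)) c₀ W) -
                  (LinearMap.toContinuousLinearMap (laplaceAkPi L m n φ τ η U a' hposU' hL αU hα1 hU1 hreg (c₁ := c₁) a) :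
                      BondL2K ℂ d (towerP L m (n + 1)) c₀ W →L[ℂ] BondL2K ℂ d (towerP L m (n + 1)) c₀ W)))) z) ∧
          (∀ z : ℂ, ‖z‖ ≤ R₁ →
            ‖Ring.inverse ((LinearMap.toContinuousLinearMap (laplaceAkPi L m n φ τ η U a' hposU' hL αU hα1 hU1 hreg (c₁ := c₁) a) :
                  BondL2K ℂ d (towerP L m (n + 1)) c₀ W →L[ℂ] BondL2K ℂ d (towerP L m (n + 1)) c₀ W) +
                z • ((LinearMap.toContinuousLinearMap (laplaceAkPi L m n φ τ η V a' hposV' hL αV hα1' hV1 hregV (c₁ := c₁) a) :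
                      BondL2K ℂ d (towerP L m (n + 1)) c₀ W →L[ℂ] BondL2K ℂ d (towerP L m (n + 1)) c₀ W) -
                  (LinearMap.toContinuousLinearMap (laplaceAkPi L m n φ τ η U a' hposU' hL αU hα1 hU1 hreg (c₁ := c₁) a) :
                      BondL2K ℂ d (towerP L m (n + 1)) c₀ W →L[ℂ] BondL2K ℂ d (towerP L m (n + 1)) c₀ W)))‖ ≤ (γ - R₁ * (Θ * δ))⁻¹) ∧
          (∀ z : ℂ, ‖z‖ ≤ R₁ → ∀ y : BondL2K ℂ d (towerP L m (n + 1)) c₀ W,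
            Real.sqrt (‖covCurlL2K ℂ c₀ ((η : ℂ))⁻¹ (adTransportW φ (fun _ : Bond d (towerP L m (n + 1)) => (1 : 𝔸ˣ)))
                  (Ring.inverse ((LinearMap.toContinuousLinearMap (laplaceAkPi L m n φ τ η U a' hposU' hL αU hα1 hU1 hreg (c₁ := c₁) a) :
                        BondL2K ℂ d (towerP L m (n + 1)) c₀ W →L[ℂ] BondL2K ℂ d (towerP L m (n + 1)) c₀ W) +
                      z • ((LinearMap.toContinuousLinearMap (laplaceAkPi L m n φ τ η V a' hposV' hL αV hα1' hV1 hregV (c₁ := c₁) a) :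
                            BondL2K ℂ d (towerP L m (n + 1)) c₀ W →L[ℂ] BondL2K ℂ d (towerP L m (n + 1)) c₀ W) -
                        (LinearMap.toContinuousLinearMap (laplaceAkPi L m n φ τ η U a' hposU' hL αU hα1 hU1 hreg (c₁ := c₁) a) :
                            BondL2K ℂ d (towerP L m (n + 1)) c₀ W →L[ℂ] BondL2K ℂ d (towerP L m (n + 1)) c₀ W))) y)‖ ^ 2 +
                ‖covDivL2K ℂ c₀ ((η : ℂ))⁻¹ (adTransportW φ fun _ : Bond d (towerP L m (n + 1)) => (1 : 𝔸ˣ)⁻¹)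
                  (Ring.inverse ((LinearMap.toContinuousLinearMap (laplaceAkPi L m n φ τ η U a' hposU' hL αU hα1 hU1 hreg (c₁ := c₁) a) :
                        BondL2K ℂ d (towerP L m (n + 1)) c₀ W →L[ℂ] BondL2K ℂ d (towerP L m (n + 1)) c₀ W) +
                      z • ((LinearMap.toContinuousLinearMap (laplaceAkPi L m n φ τ η V a' hposV' hL αV hα1' hV1 hregV (c₁ := c₁) a) :
                            BondL2K ℂ d (towerP L m (n + 1)) c₀ W →L[ℂ] BondL2K ℂ d (towerP L m (n + 1)) c₀ W) -
                        (LinearMap.toContinuousLinearMap (laplaceAkPi L m n φ τ η U a' hposU' hL αU hα1 hU1 hreg (c₁ := c₁) a) :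
                            BondL2K ℂ d (towerP L m (n + 1)) c₀ W →L[ℂ] BondL2K ℂ d (towerP L m (n + 1)) c₀ W))) y)‖ ^ 2 +
                ‖Ring.inverse ((LinearMap.toContinuousLinearMap (laplaceAkPi L m n φ τ η U a' hposU' hL αU hα1 hU1 hreg (c₁ := c₁) a) :
                        BondL2K ℂ d (towerP L m (n + 1)) c₀ W →L[ℂ] BondL2K ℂ d (towerP L m (n + 1)) c₀ W) +
                      z • ((LinearMap.toContinuousLinearMap (laplaceAkPi L m n φ τ η V a' hposV' hL αV hα1' hV1 hregV (c₁ := c₁) a) :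
                            BondL2K ℂ d (towerP L m (n + 1)) c₀ W →L[ℂ] BondL2K ℂ d (towerP L m (n + 1)) c₀ W) -
                        (LinearMap.toContinuousLinearMap (laplaceAkPi L m n φ τ η U a' hposU' hL αU hα1 hU1 hreg (c₁ := c₁) a) :
                            BondL2K ℂ d (towerP L m (n + 1)) c₀ W →L[ℂ] BondL2K ℂ d (towerP L m (n + 1)) c₀ W))) y‖ ^ 2) ≤
              (γ - R₁ * (Θ * δ))⁻¹ * ‖y‖) ∧
          (1 < R₁ →
            ‖Ring.inverse (LinearMap.toContinuousLinearMap (laplaceAkPi L m n φ τ η V a' hposV' hL αV hα1' hV1 hregV (c₁ := c₁) a) :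
                  BondL2K ℂ d (towerP L m (n + 1)) c₀ W →L[ℂ] BondL2K ℂ d (towerP L m (n + 1)) c₀ W) -
              Ring.inverse (LinearMap.toContinuousLinearMap (laplaceAkPi L m n φ τ η U a' hposU' hL αU hα1 hU1 hreg (c₁ := c₁) a) :
                  BondL2K ℂ d (towerP L m (n + 1)) c₀ W →L[ℂ] BondL2K ℂ d (towerP L m (n + 1)) c₀ W)‖ ≤ (γ - R₁ * (Θ * δ))⁻¹ / (R₁ - 1)) := by
  obtain ⟨α₁, γ₁, hα₁, hγ₁, H1⟩ := exists_laplaceAkPi_coercive_diagonal_closed (d := d) L hL φ hMφ hMφ' hφ hφ' ha ha' hr0 hr1 τ hτ hCτ hρw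
  obtain ⟨α₂, δ₀, Θ, hα₂, hδ₀, hΘ, H2⟩ :=
    exists_form_defect_pi_two_backgrounds_letterfree (d := d) L hL φ hMφ hMφ' hφ hφ' ha ha' hr0 hr1 τ hτ hCτ hρw
  refine ⟨min α₁ α₂, δ₀, γ₁, Θ, lt_min hα₁ hα₂, hδ₀, hγ₁, hΘ, ?_⟩
  intro n η hηL c₀ c₁ _ _ hw hρ m _ U V αU hα1 hU1 hreg αV hα1' hV1 hregV hα128 εU hεU hUε hVε δUV hδUV hLUV α δ hα0 hαle hδ0 hδle
    hRSU hRSV hUb hVb hUη hVη hplU hplV hUV hpp hεg hδg hposU' hposV' R₁ hR₁ hgap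
  have hαα₁ : α ≤ α₁ := hαle.trans (min_le_left _ _)
  have hαα₂ : α ≤ α₂ := hαle.trans (min_le_right _ _)
  have hLbU := hLb_of_hU1 L m n U hU1
  have HU := H1 n η hηL c₀ c₁ hw hρ m U αU hα1 hU1 hreg εU hεU hUε hα0 hαα₁ hRSU hUb hUη hplU hεg hLbU hposU'
  have HT := H2 n η hηL c₀ c₁ hw hρ m U V αU hα1 hU1 hreg αV hα1' hV1 hregV hα128 εU hεU hUε hVε δUV hδUV hLUV hα0 hαα₂ hδ0 hδle hRSU hRSV
    hUb hVb hUη hVη hplU hplV hUV hpp hεg hδg hposU' hposV'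
  have hΘδ : 0 ≤ Θ * δ := mul_nonneg hΘ.le hδ0
  -- the two pencil members as continuous linear maps
  set S₀ : BondL2K ℂ d (towerP L m (n + 1)) c₀ W →L[ℂ] BondL2K ℂ d (towerP L m (n + 1)) c₀ W :=
    LinearMap.toContinuousLinearMap (laplaceAkPi L m n φ τ η U a' hposU' hL αU hα1 hU1 hreg (c₁ := c₁) a) with hS₀
  set S₁ : BondL2K ℂ d (towerP L m (n + 1)) c₀ W →L[ℂ] BondL2K ℂ d (towerP L m (n + 1)) c₀ W :=
    LinearMap.toContinuousLinearMap (laplaceAkPi L m n φ τ η V a' hposV' hL αV hα1' hV1 hregV (c₁ := c₁) a) with hS₁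
  -- the flat energy weight `N₁`
  obtain ⟨N, hNdef⟩ : ∃ N : BondL2K ℂ d (towerP L m (n + 1)) c₀ W → ℝ, N = fun z =>
      Real.sqrt (‖covCurlL2K ℂ c₀ ((η : ℂ))⁻¹ (adTransportW φ (fun _ : Bond d (towerP L m (n + 1)) => (1 : 𝔸ˣ))) z‖ ^ 2 +
        ‖covDivL2K ℂ c₀ ((η : ℂ))⁻¹ (adTransportW φ fun _ : Bond d (towerP L m (n + 1)) => (1 : 𝔸ˣ)⁻¹) z‖ ^ 2 + ‖z‖ ^ 2) := ⟨_, rfl⟩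
  have hNz : ∀ z, N z = Real.sqrt (‖covCurlL2K ℂ c₀ ((η : ℂ))⁻¹ (adTransportW φ (fun _ : Bond d (towerP L m (n + 1)) => (1 : 𝔸ˣ))) z‖ ^ 2 +
      ‖covDivL2K ℂ c₀ ((η : ℂ))⁻¹ (adTransportW φ fun _ : Bond d (towerP L m (n + 1)) => (1 : 𝔸ˣ)⁻¹) z‖ ^ 2 + ‖z‖ ^ 2) := fun z => by rw [hNdef]
  have hN0 : ∀ z, 0 ≤ N z := fun z => by rw [hNz]; exact Real.sqrt_nonneg _
  have hNsq : ∀ z, N z ^ 2 = ‖covCurlL2K ℂ c₀ ((η : ℂ))⁻¹ (adTransportW φ (fun _ : Bond d (towerP L m (n + 1)) => (1 : 𝔸ˣ))) z‖ ^ 2 +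
      ‖covDivL2K ℂ c₀ ((η : ℂ))⁻¹ (adTransportW φ fun _ : Bond d (towerP L m (n + 1)) => (1 : 𝔸ˣ)⁻¹) z‖ ^ 2 + ‖z‖ ^ 2 := fun z => by
    rw [hNz]; exact Real.sq_sqrt (add_nonneg (add_nonneg (sq_nonneg _) (sq_nonneg _)) (sq_nonneg _))
  have hNn : ∀ z, ‖z‖ ≤ N z := fun z => by
    rw [hNz]; exact le_sqrt_of_sq_le (norm_nonneg _) (le_add_of_nonneg_left (add_nonneg (sq_nonneg _) (sq_nonneg _)))
  -- the pencil's two letters: `hco` at `U`, `hD` between `U` and `V`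
  have hco : ∀ u, γ₁ * N u ^ 2 ≤ RCLike.re ⟪u, S₀ u⟫_ℂ := fun u => by
    rw [hNsq, hS₀, LinearMap.coe_toContinuousLinearMap']; exact HU u
  have hD : ∀ u v, ‖⟪u, (S₁ - S₀) v⟫_ℂ‖ ≤ Θ * δ * N u * N v := fun u v => by
    rw [sub_apply, hS₀, hS₁, LinearMap.coe_toContinuousLinearMap', LinearMap.coe_toContinuousLinearMap', inner_sub_right,
      norm_sub_rev, hNz u, hNz v]
    exact HT u v
  refine ⟨fun ν => ?_, fun z hz => ?_, fun z hz => ?_, fun z hz y => ?_, fun hR₁1 => ?_⟩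
  · exact norm_iteratedDeriv_inverse_pencil_le N hN0 hNn hΘδ hR₁ hgap S₀ (S₁ - S₀) hco hD ν
  · exact analyticAt_inverse_pencil N hN0 hNn hΘδ hgap S₀ (S₁ - S₀) hco hD hz
  · exact norm_inverse_pencil_le N hN0 hNn hΘδ hgap S₀ (S₁ - S₀) hco hD hz
  · rw [← hNz]; exact weight_inverse_pencil_apply_le N hN0 hNn hΘδ hgap S₀ (S₁ - S₀) hco hD hz y
  · have h := norm_inverse_add_sub_inverse_le N hN0 hNn hΘδ hgap S₀ (S₁ - S₀) hco hD hR₁1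
    rwa [add_sub_cancel] at h

/-! ## §3 The small first order read off the pencil -/

/-- **THE SMALL FIRST ORDER OFF THE PENCIL**: under the binder list of §2 with `0 < δ` and the window `Θδ < γ`, the MIDPOINT radius
`R₁⋆ := (γ + Θδ)∕(2Θδ)` of the admissible interval `(1, γ∕(Θδ))` (where `(γ − R₁⋆Θδ)(R₁⋆ − 1) = (γ − Θδ)²∕(4Θδ)` is maximal) gives
`‖S₁⁻¹ − S₀⁻¹‖ ≤ 4Θδ∕(γ − Θδ)²` — order `Θδ∕γ²`, the order of (T4)-2's `(Θ∕γ)γ⁻¹δ` with a worse constant (the honest comparison of the module header; the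
radius choice is t4-ne9-idea-1 g153's located remark L-g153-3, cell journal 2026-08-25 l.64557). [folklore]
[cite: Balaban1985BackgroundPropagators, (3.122) p.420, Thm 3.4 p.400, (3.86) p.407, Thm 3.11 p.416; Kato1966, Ch. VII §4] -/
theorem exists_inverse_laplaceAkPi_sub_inverse_le_two_backgrounds_letterfree :
    ∃ α₀ δ₀ γ Θ : ℝ, 0 < α₀ ∧ 0 < δ₀ ∧ 0 < γ ∧ 0 < Θ ∧ ∀ (n : ℕ) (η : ℝ), η * (L : ℝ) ^ (n + 1) = 1 →
      ∀ (c₀ c₁ : ℝ) [Fact (0 < c₀)] [Fact (0 < c₁)], c₀ * ((L : ℝ) ^ (n + 1)) ^ d = c₁ → |η| ^ d / c₀ ≤ ρw →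
      ∀ (m : Fin d → ℕ) [∀ i, NeZero (m i)] (U V : Bond d (towerP L m (n + 1)) → 𝔸ˣ) (αU : ℕ → ℝ) (hα1 : ∀ j, αU j ≤ 1 / 64)
        (hU1 : ∀ (j : ℕ) (x : B7Prop1Explicit.Site d) (κ : Fin d), perCfg (towerP L m (j + 1)) (UlevOf L m (n + 1) U j) x κ ∈ U1 𝔸)
        (hreg : ∀ (j : ℕ) (y : TSite d (towerP L m j)) (κ : Fin d) (r : Fin d → Fin L),
          ‖((Wcx L (perCfg (towerP L m (j + 1)) (UlevOf L m (n + 1) U j)) (cornerSite L y) κ (boxVec L r) : 𝔸ˣ) : 𝔸) - 1‖ ≤ αU j)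
        (αV : ℕ → ℝ) (hα1' : ∀ j, αV j ≤ 1 / 64)
        (hV1 : ∀ (j : ℕ) (x : B7Prop1Explicit.Site d) (κ : Fin d), perCfg (towerP L m (j + 1)) (UlevOf L m (n + 1) V j) x κ ∈ U1 𝔸)
        (hregV : ∀ (j : ℕ) (y : TSite d (towerP L m j)) (κ : Fin d) (r : Fin d → Fin L),
          ‖((Wcx L (perCfg (towerP L m (j + 1)) (UlevOf L m (n + 1) V j)) (cornerSite L y) κ (boxVec L r) : 𝔸ˣ) : 𝔸) - 1‖ ≤ αV j),
        (∀ j, αV j ≤ 1 / 128) →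
      ∀ (εU : ℕ → ℝ), (∀ j, 0 ≤ εU j) → (∀ (j : ℕ) (b : Bond d (towerP L m (j + 1))), ‖(UlevOf L m (n + 1) U j b : 𝔸) - 1‖ ≤ εU j) →
        (∀ (j : ℕ) (b : Bond d (towerP L m (j + 1))), ‖(UlevOf L m (n + 1) V j b : 𝔸) - 1‖ ≤ εU j) →
      ∀ (δUV : ℕ → ℝ), (∀ j, 0 ≤ δUV j) →
        (∀ (j : ℕ) (b : Bond d (towerP L m (j + 1))), ‖(UlevOf L m (n + 1) U j b : 𝔸) - (UlevOf L m (n + 1) V j b : 𝔸)‖ ≤ δUV j) →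
      ∀ {α δ : ℝ}, 0 ≤ α → α ≤ α₀ → 0 < δ → δ ≤ δ₀ → Θ * δ < γ →
        (∀ (b : Bond d (towerP L m (n + 1))) (v u : W), ⟪adTransportW φ U b v, u⟫_ℂ = ⟪v, adTransportW φ (fun b => (U b)⁻¹) b u⟫_ℂ) →
        (∀ (b : Bond d (towerP L m (n + 1))) (v u : W), ⟪adTransportW φ V b v, u⟫_ℂ = ⟪v, adTransportW φ (fun b => (V b)⁻¹) b u⟫_ℂ) →
        (∀ b, U b ∈ U1 𝔸) → (∀ b, V b ∈ U1 𝔸) → (∀ b, ‖(U b : 𝔸) - 1‖ ≤ α * η) → (∀ b, ‖(V b : 𝔸) - 1‖ ≤ α * η) →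
        (∀ p : B9SectCLatticeCarrier.Plaq d (towerP L m (n + 1)), ‖(plaqHolU U p : 𝔸) - 1‖ ≤ α * η ^ 2) →
        (∀ p : B9SectCLatticeCarrier.Plaq d (towerP L m (n + 1)), ‖(plaqHolU V p : 𝔸) - 1‖ ≤ α * η ^ 2) →
        (∀ b, ‖(U b : 𝔸) - (V b : 𝔸)‖ ≤ δ * η) →
        (∀ p : B9SectCLatticeCarrier.Plaq d (towerP L m (n + 1)), ‖(plaqHolU U p : 𝔸) - (plaqHolU V p : 𝔸)‖ ≤ δ * η ^ 2) →
        (∀ j < n + 1, εU j ≤ α * r ^ j) → (∀ j, δUV j ≤ δ * r ^ j) →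
        ∀ (hposU' : ∀ x : SiteL2K ℂ d (towerP L m (n + 1)) c₀ W, x ≠ 0 → 0 < RCLike.re ⟪x, laplacePrimeAk L m n φ η U a' (c₁ := c₁) x⟫_ℂ)
          (hposV' : ∀ x : SiteL2K ℂ d (towerP L m (n + 1)) c₀ W, x ≠ 0 → 0 < RCLike.re ⟪x, laplacePrimeAk L m n φ η V a' (c₁ := c₁) x⟫_ℂ),
          ‖Ring.inverse (LinearMap.toContinuousLinearMap (laplaceAkPi L m n φ τ η V a' hposV' hL αV hα1' hV1 hregV (c₁ := c₁) a) :
                BondL2K ℂ d (towerP L m (n + 1)) c₀ W →L[ℂ] BondL2K ℂ d (towerP L m (n + 1)) c₀ W) -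
            Ring.inverse (LinearMap.toContinuousLinearMap (laplaceAkPi L m n φ τ η U a' hposU' hL αU hα1 hU1 hreg (c₁ := c₁) a) :
                BondL2K ℂ d (towerP L m (n + 1)) c₀ W →L[ℂ] BondL2K ℂ d (towerP L m (n + 1)) c₀ W)‖ ≤ 4 * (Θ * δ) / (γ - Θ * δ) ^ 2 := by
  obtain ⟨α₀, δ₀, γ, Θ, hα₀, hδ₀, hγ, hΘ, H⟩ :=
    exists_inverse_laplaceAkPi_pencil_two_backgrounds_letterfree (d := d) L hL φ hMφ hMφ' hφ hφ' ha ha' hr0 hr1 τ hτ hCτ hρw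
  refine ⟨α₀, δ₀, γ, Θ, hα₀, hδ₀, hγ, hΘ, ?_⟩
  intro n η hηL c₀ c₁ _ _ hw hρ m _ U V αU hα1 hU1 hreg αV hα1' hV1 hregV hα128 εU hεU hUε hVε δUV hδUV hLUV α δ hα0 hαle hδ0 hδle hwin
    hRSU hRSV hUb hVb hUη hVη hplU hplV hUV hpp hεg hδg hposU' hposV'
  -- the midpoint radius `R₁⋆ = (γ + Θδ)∕(2Θδ)` of the admissible interval `(1, γ∕(Θδ))` (t4-ne9-idea-1 g153, L-g153-3)
  have ht : 0 < Θ * δ := mul_pos hΘ hδ0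
  have hR₁ : 0 < (γ + Θ * δ) / (2 * (Θ * δ)) := by positivity
  have hmul : (γ + Θ * δ) / (2 * (Θ * δ)) * (Θ * δ) = (γ + Θ * δ) / 2 := by
    rw [div_mul_eq_mul_div, mul_div_mul_right _ _ ht.ne']
  have hR₁1 : 1 < (γ + Θ * δ) / (2 * (Θ * δ)) := by rw [lt_div_iff₀ (by positivity)]; linarith
  have hgap : (γ + Θ * δ) / (2 * (Θ * δ)) * (Θ * δ) < γ := by rw [hmul]; linarith
  have h := (H n η hηL c₀ c₁ hw hρ m U V αU hα1 hU1 hreg αV hα1' hV1 hregV hα128 εU hεU hUε hVε δUV hδUV hLUV hα0 hαle hδ0.le hδle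
    hRSU hRSV hUb hVb hUη hVη hplU hplV hUV hpp hεg hδg hposU' hposV' hR₁ hgap).2.2.2.2 hR₁1
  have e : (γ - (γ + Θ * δ) / (2 * (Θ * δ)) * (Θ * δ))⁻¹ / ((γ + Θ * δ) / (2 * (Θ * δ)) - 1) = 4 * (Θ * δ) / (γ - Θ * δ) ^ 2 := by
    rw [hmul, div_sub_one (by positivity : (2 * (Θ * δ)) ≠ 0), show γ - (γ + Θ * δ) / 2 = (γ - Θ * δ) / 2 by ring,
      show γ + Θ * δ - 2 * (Θ * δ) = γ - Θ * δ by ring, inv_div, div_div_eq_mul_div, div_mul_eq_mul_div, div_div, sq]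
    ring
  rwa [e] at h

end Literature.MathematicalPhysics.QuantumFieldTheory.Balaban1983to89.B9Eq386GreenkAnalyticPencilEnergyPiTwoBackgrounds

end
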